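import Literature.NumberTheory.LFunctions.BettinConreyFarmer2013ZeroSumAnalytic
import Literature.NumberTheory.LFunctions.BettinConreyFarmer2013LocalFactor
import Mathlib.Analysis.SpecialFunctions.JapaneseBracket
import HarnessLib

/-!
# Bettin–Conrey–Farmer 2013, Theorem 1 — the main-term integrand `Ψ_N`: poles, bounds, and the
# contour shift across the critical zeros

Topic `Literature/NumberTheory/LFunctions`; "Proofs" companion of `BettinConreyFarmer2013.lean`
(sixth in the chain `…Zeros → …ZeroSums → …LocalFactor / …ExplicitFormula → …ZeroSumAnalytic →
this file`). Everything here is PROVED; the only definition is `BCF.Psi` (explicit body).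
The main term in the proof of Theorem 1 of [BettinConreyFarmer2013, §3] is
`−(log N)⁻²(2πi)⁻¹ ∫_{(1/2−ε)} Ψ_N(s) ds` with

  `Ψ_N(s) = ζ'/ζ(1−s) · ζ(s) · Z_N(s) / (s(1−s))`,  `Z_N(s) = ∑_ρ N^{ρ−s}/(ζ'(ρ)(ρ−s)²)`

(display (etr) and the last display of the proof: "moving the line of integration in (etr) to
`Re(s) = 1/2 + ε` we get that the integral is equal to `(log N)⁻¹ ∑_ρ 1/|ρ|² + O(log⁻² N)`").
Under RH, simple zeros and condition (2) (`0 < δ ≤ 1`), for `0 < ε ≤ 1/16`, this file proves: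

* **Part 1 (poles).** `BCF.exists_norm_logDeriv_line_le` — `|ζ'/ζ(σ+it)| ≤ C log(|t|+2)` for
  `1/4 ≤ σ ≤ 3/4`, `|σ − 1/2| ≥ ε`; `BCF.analyticAt_Psi` — `Ψ_N` is analytic on the strip
  `1/4 ≤ Re s ≤ 3/4` off the zeros; `BCF.poleData_Psi` — at each zero `ρ₀`, `Ψ_N = φ/(s−ρ₀)²` with
  `φ` holomorphic near `ρ₀` and `‖φ'(ρ₀) − log N/(ρ₀(1−ρ₀))‖ ≤ 3M/(r²|ζ'(ρ₀)||ρ₀|²) + (1+2|ρ₀|)/|ρ₀|⁴`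
  ("residue `log N/|ρ|² + O(1/(|ρ|^{2−ε}|ζ'(ρ)|) + 1/|ρ|²)`", loc. cit.).
* **Part 2 (bounds).** `BCF.exists_norm_Psi_line_le`, `BCF.exists_integral_Psi_line` — on
  `Re s = x`, `|x − 1/2| = ε`: `‖Ψ_N(x+iy)‖ ≤ K N^{1/2−x}(1+|y|)^{−(9/8−2ε+δ/4)}`, so
  `‖∫ Ψ_N(x+iy) dy‖ ≤ K' N^{1/2−x}`; `BCF.exists_norm_Psi_horizontal_le` — on `Im s = ±T` at a good
  height, `|Re s − 1/2| ≤ ε`: `‖Ψ_N(s)‖ ≤ K N^{ε} T^{−1/8}`.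
* **Part 3 (main term).** `BCF.exists_main_term` — for all `N ≥ 2`,
  `‖∫ Ψ_N(1/2−ε+iy) dy + 2π log N ∑_ρ 1/(ρ(1−ρ))‖ ≤ R` (`R` independent of `N`), by the residue
  theorem between `Re s = 1/2 ∓ ε`
  (`Literature.Analysis.Complex.integral_vertical_sub_eq_tsum_of_doublePoles`, horizontal sides at
  the good heights of `ZetaLogDerivRH.exists_goodHeight`), the residues summing to
  `log N ∑_ρ 1/(ρ(1−ρ)) + O(1)` (`BCF.summable_err`, `BCF.exists_poleData_all`) and
  `∫ Ψ_N(1/2+ε+iy) dy = O(N^{−ε})`.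

## References

* S. Bettin, J. B. Conrey, D. W. Farmer, *An optimal choice of Dirichlet polynomials for the
  Nyman–Beurling criterion*, Proc. Steklov Inst. Math. 280 (2013), suppl. 2, S30–S36
  (arXiv:1211.5191), §3, Lemmas 2–3 and the proof of Theorem 1. [BettinConreyFarmer2013]
-/

noncomputable section

open Complex Filter Set Real Metric MeromorphicOn
open scoped Topology ComplexConjugate

namespace Literature.NumberTheory.LFunctions

namespace BCF

/-! ## The integrand -/

/-- The main-term integrand `Ψ_N(s) = ζ'/ζ(1−s) · ζ(s) · Z_N(s)/(s(1−s))`.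
[cite: BettinConreyFarmer2013, §3, proof of Thm. 1 (display etr)] -/
def Psi (N : ℕ) (s : ℂ) : ℂ :=
  deriv riemannZeta (1 - s) / riemannZeta (1 - s) * riemannZeta s * zeroSum N s / (s * (1 - s))

/-! ## `ζ'/ζ` on the lines `|Re s − 1/2| ≥ ε` under RH -/

/-- **`|ζ'/ζ(σ + it)| ≤ C log(|t| + 2)` for `1/4 ≤ σ ≤ 3/4`, `|σ − 1/2| ≥ ε`, under RH** (the
zeros are on the line at distance `≥ ε` from `s`; partial fraction of `ζ'/ζ`,
`Literature.NumberTheory.LFunctions.exists_norm_logDeriv_zeta_sub_sum_le`, for `|t| ≥ 2`, compactness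
below). [cite: MontgomeryVaughan2007, Lemma 12.1] -/
theorem exists_norm_logDeriv_line_le (hRH : RiemannHypothesis) {ε : ℝ} (hε : 0 < ε) (hε4 : ε ≤ 1 / 4) :
    ∃ C : ℝ, 0 < C ∧ ∀ σ t : ℝ, σ ∈ Icc (1 / 4 : ℝ) (3 / 4) → ε ≤ |σ - 1 / 2| →
      riemannZeta (σ + t * I) ≠ 0 ∧
      ‖deriv riemannZeta (σ + t * I) / riemannZeta (σ + t * I)‖ ≤ C * Real.log (|t| + 2) := by
  obtain ⟨C₁, hC₁0, hC₁⟩ := exists_norm_logDeriv_zeta_sub_sum_le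
  have hne : ∀ σ t : ℝ, σ ∈ Icc (1 / 4 : ℝ) (3 / 4) → ε ≤ |σ - 1 / 2| → riemannZeta (σ + t * I) ≠ 0 := by
    intro σ t hσ hd
    refine riemannZeta_ne_zero_of_riemannHypothesis hRH (by simp; linarith [hσ.1]) ?_
    simp only [add_re, ofReal_re, mul_re, I_re, mul_zero, ofReal_im, I_im, mul_one, sub_self, add_zero]
    intro h; rw [h, sub_self, abs_zero] at hd; linarith
  -- the compact part `|t| ≤ 2`
  set K : Set ℂ := ((Icc (1 / 4 : ℝ) (1 / 2 - ε) ∪ Icc (1 / 2 + ε) (3 / 4)) ×ℂ Icc (-2 : ℝ) 2) with hK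
  have hKc : IsCompact K := (isCompact_Icc.union isCompact_Icc).reProdIm isCompact_Icc
  have hKζ : ∀ z ∈ K, riemannZeta z ≠ 0 ∧ z ≠ 1 := by
    intro z hz
    rw [hK, Complex.mem_reProdIm] at hz
    obtain ⟨hre, him⟩ := hz
    have hre' : 1 / 4 ≤ z.re ∧ z.re ≤ 3 / 4 ∧ ε ≤ |z.re - 1 / 2| := by
      rcases hre with h | h
      · exact ⟨h.1, by linarith [h.2], by rw [abs_of_nonpos (by linarith [h.2])]; linarith [h.2]⟩
      · exact ⟨by linarith [h.1], h.2, by rw [abs_of_nonneg (by linarith [h.1])]; linarith [h.1]⟩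
    refine ⟨?_, fun h ↦ by rw [h, one_re] at hre'; linarith [hre'.2.1]⟩
    have := hne z.re z.im ⟨hre'.1, hre'.2.1⟩ hre'.2.2
    rwa [Complex.re_add_im] at this
  have hcont : ContinuousOn (fun z ↦ deriv riemannZeta z / riemannZeta z) K := by
    intro z hz
    obtain ⟨hζ, h1⟩ := hKζ z hz
    exact (((analyticOn_riemannZeta z h1).deriv.continuousAt).div
      (differentiableAt_riemannZeta h1).continuousAt hζ).continuousWithinAt
  obtain ⟨B, hB⟩ := hKc.exists_bound_of_continuousOn hcont
  have hB0 : 0 ≤ B := (norm_nonneg _).trans (hB ((1 / 4 : ℝ) : ℂ) (by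
    rw [hK, Complex.mem_reProdIm]
    refine ⟨Or.inl ⟨by simp, by simp; linarith⟩, by simp⟩))
  have hlog2 : 0 < Real.log 2 := Real.log_pos (by norm_num)
  refine ⟨C₁ + (7 / Real.log (39 / 37)) / ε + B / Real.log 2 + 1, by
    have := Real.log_pos (show (1 : ℝ) < 39 / 37 by norm_num); positivity, fun σ t hσ hd ↦ ⟨hne σ t hσ hd, ?_⟩⟩
  have hl2 : Real.log 2 ≤ Real.log (|t| + 2) := Real.log_le_log two_pos (by linarith [abs_nonneg t])
  have hl0 : 0 < Real.log (|t| + 2) := hlog2.trans_le hl2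
  have h39 : 0 < 7 / Real.log (39 / 37) := by
    have := Real.log_pos (show (1 : ℝ) < 39 / 37 by norm_num); positivity
  by_cases ht : 2 ≤ |t|
  · set z : ℂ := σ + t * I with hz
    have hzmem : z ∈ closedBall (2 + (t : ℂ) * I) (7 / 4) := by
      rw [mem_closedBall, dist_eq_norm, hz,
        show (σ : ℂ) + t * I - (2 + t * I) = ((σ - 2 : ℝ) : ℂ) by push_cast; ring,
        Complex.norm_real, Real.norm_eq_abs, abs_le]
      constructor <;> linarith [hσ.1, hσ.2]
    have h1 := hC₁ t ht z hzmem (hne σ t hσ hd)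
    have hfar : ∀ u ∈ Function.support (divisor riemannZeta (closedBall (2 + (t : ℂ) * I) (37 / 20))),
        ε ≤ ‖z - u‖ := by
      intro u hu
      obtain ⟨hu0, -, -, hure⟩ := zero_of_mem_support_divisor_zetaDisc ht hu
      have hu12 := re_eq_one_half_of_riemannHypothesis hRH hu0 (by linarith)
      refine le_trans ?_ (abs_re_le_norm (z - u))
      rw [sub_re, hu12, hz]
      simpa using hd
    have h2 := norm_sum_divisor_zetaDisc_le ht hε hfar
    calc ‖deriv riemannZeta z / riemannZeta z‖
        = ‖(deriv riemannZeta z / riemannZeta z -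
            ∑ u ∈ ((divisor riemannZeta (closedBall (2 + (t : ℂ) * I) (37 / 20))).finiteSupport
                (isCompact_closedBall (2 + (t : ℂ) * I) (37 / 20))).toFinset,
              (divisor riemannZeta (closedBall (2 + (t : ℂ) * I) (37 / 20)) u : ℂ) / (z - u)) +
            ∑ u ∈ ((divisor riemannZeta (closedBall (2 + (t : ℂ) * I) (37 / 20))).finiteSupport
                (isCompact_closedBall (2 + (t : ℂ) * I) (37 / 20))).toFinset,
              (divisor riemannZeta (closedBall (2 + (t : ℂ) * I) (37 / 20)) u : ℂ) / (z - u)‖ := by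
          rw [sub_add_cancel]
      _ ≤ C₁ * Real.log (|t| + 2) + (7 / Real.log (39 / 37)) * Real.log (|t| + 2) / ε :=
          (norm_add_le _ _).trans (add_le_add h1 h2)
      _ = (C₁ + (7 / Real.log (39 / 37)) / ε) * Real.log (|t| + 2) := by ring
      _ ≤ (C₁ + (7 / Real.log (39 / 37)) / ε + B / Real.log 2 + 1) * Real.log (|t| + 2) := by
          have : 0 ≤ (B / Real.log 2 + 1) * Real.log (|t| + 2) := by positivity
          nlinarith
  · rw [not_le] at ht
    have hmem : ((σ : ℂ) + t * I) ∈ K := by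
      rw [hK, Complex.mem_reProdIm]
      simp only [add_re, ofReal_re, mul_re, I_re, mul_zero, ofReal_im, I_im, mul_one, sub_self,
        add_zero, add_im, mul_im, zero_add, mem_Icc]
      refine ⟨?_, abs_le.1 ht.le⟩
      rcases le_or_gt σ (1 / 2) with h | h
      · left; rw [abs_of_nonpos (by linarith)] at hd; exact ⟨hσ.1, by linarith⟩
      · right; rw [abs_of_nonneg (by linarith)] at hd; exact ⟨by linarith, hσ.2⟩
    calc ‖deriv riemannZeta (σ + t * I) / riemannZeta (σ + t * I)‖ ≤ B := hB _ hmem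
      _ = B / Real.log 2 * Real.log 2 := by field_simp
      _ ≤ B / Real.log 2 * Real.log (|t| + 2) := by gcongr
      _ ≤ (C₁ + (7 / Real.log (39 / 37)) / ε + B / Real.log 2 + 1) * Real.log (|t| + 2) := by
          have : 0 ≤ (C₁ + (7 / Real.log (39 / 37)) / ε + 1) * Real.log (|t| + 2) := by positivity
          nlinarith

/-! ## Analyticity of `Ψ_N` off the zeros -/

/-- In the strip `1/4 ≤ Re s ≤ 3/4`, under RH, `ζ(1−s) = 0` only at non-trivial zeros `s`. [folklore] -/
theorem zeta_one_sub_ne_zero (hRH : RiemannHypothesis) {s : ℂ} (h1 : 1 / 4 ≤ s.re) (h2 : s.re ≤ 3 / 4)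
    (hs : s ∉ ZetaZeros.riemannZetaNontrivialZeros) : riemannZeta (1 - s) ≠ 0 := by
  intro h0
  have hmem : (1 - s) ∈ ZetaZeros.riemannZetaNontrivialZeros :=
    ZetaZeros.riemannZetaNontrivialZeros.mem_iff'.2 ⟨h0, by simp; linarith, by simp; linarith⟩
  have hc := ZetaZeros.riemannZetaNontrivialZeros.conj_mem hmem
  have e : conj (1 - s) = s := by
    have hre : (1 - s).re = 1 / 2 := ntz_re hRH hmem
    apply Complex.ext
    · simp at hre ⊢; linarith
    · simp
  rw [e] at hc
  exact hs hc

/-- **`Ψ_N` is analytic at every point of the strip `1/4 ≤ Re s ≤ 3/4` off the zeros** (under RH and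
(2)). [cite: BettinConreyFarmer2013, §3, proof of Thm. 1] -/
theorem analyticAt_Psi (hRH : RiemannHypothesis) {δ C : ℝ} (hδ : 0 < δ)
    (hC : ∀ T : ℝ, 2 ≤ T →
      ∑ᶠ ρ ∈ zetaZeroBox 0 T, 1 / ‖deriv riemannZeta ρ‖ ^ 2 ≤ C * T ^ (3 / 2 - δ))
    {N : ℕ} (hN : 2 ≤ N) {s : ℂ} (h1 : 1 / 4 ≤ s.re) (h2 : s.re ≤ 3 / 4)
    (hs : s ∉ ZetaZeros.riemannZetaNontrivialZeros) : AnalyticAt ℂ (Psi N) s := by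
  have hs1 : s ≠ 1 := fun h ↦ by rw [h, one_re] at h2; norm_num at h2
  have hs0 : s ≠ 0 := fun h ↦ by rw [h, zero_re] at h1; norm_num at h1
  have hs1' : (1 - s) ≠ 1 := fun h ↦ hs0 (by linear_combination -h)
  have hζ1 := zeta_one_sub_ne_zero hRH h1 h2 hs
  have hA : AnalyticAt ℂ (fun s ↦ deriv riemannZeta (1 - s)) s :=
    (analyticOn_riemannZeta (1 - s) hs1').deriv.comp (analyticAt_const.sub analyticAt_id)
  have hB : AnalyticAt ℂ (fun s ↦ riemannZeta (1 - s)) s :=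
    (analyticOn_riemannZeta (1 - s) hs1').comp (analyticAt_const.sub analyticAt_id)
  have hCζ : AnalyticAt ℂ riemannZeta s := analyticOn_riemannZeta s hs1
  have hZ := analyticAt_zeroSum hRH hδ hC hN hs
  have hw : AnalyticAt ℂ (fun s : ℂ ↦ s * (1 - s)) s := analyticAt_id.mul (analyticAt_const.sub analyticAt_id)
  unfold Psi
  exact (((hA.div hB hζ1).mul hCζ).mul hZ).div hw (mul_ne_zero hs0 (sub_ne_zero.2 (Ne.symm hs1)))

/-! ## The double poles of `Ψ_N` and their residues -/

/-- **Pole data of `Ψ_N` at a zero, with the residue estimate.** Assume RH, simple zeros and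
condition (2); let `N ≥ 2`, `0 < r ≤ 1/8`, `ρ₀` a non-trivial zero and `M` a bound for `|ζ|` on the
discs of radius `2r` about `ρ₀` and `1 − ρ₀`. Then near `ρ₀`, `Ψ_N = φ/(s − ρ₀)²` with `φ`
holomorphic, and the residue `φ'(ρ₀)` satisfies
`‖φ'(ρ₀) − log N/(ρ₀(1−ρ₀))‖ ≤ 3M/(r²|ζ'(ρ₀)||ρ₀|²) + (1 + 2|ρ₀|)/|ρ₀|⁴`.
[cite: BettinConreyFarmer2013, §3, proof of Thm. 1 (last display)] -/
theorem poleData_Psi (hRH : RiemannHypothesis)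
    (hsimp : ∀ ρ : ℂ, riemannZeta ρ = 0 → 0 < ρ.re → ρ.re < 1 → deriv riemannZeta ρ ≠ 0)
    {δ C : ℝ} (hδ : 0 < δ)
    (hC : ∀ T : ℝ, 2 ≤ T →
      ∑ᶠ ρ ∈ zetaZeroBox 0 T, 1 / ‖deriv riemannZeta ρ‖ ^ 2 ≤ C * T ^ (3 / 2 - δ))
    {N : ℕ} (hN : 2 ≤ N) {r : ℝ} (hr : 0 < r) (hr8 : r ≤ 1 / 8)
    {ρ₀ : ℂ} (hρ₀ : ρ₀ ∈ ZetaZeros.riemannZetaNontrivialZeros)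
    {M : ℝ} (hM : ∀ z : ℂ, (‖z - ρ₀‖ ≤ 2 * r ∨ ‖z - (1 - ρ₀)‖ ≤ 2 * r) → ‖riemannZeta z‖ ≤ M) :
    ∃ φ : ℂ → ℂ, ∃ W ∈ 𝓝 ρ₀, DifferentiableOn ℂ φ W ∧
      (∀ s ∈ W, s ≠ ρ₀ → Psi N s = φ s / (s - ρ₀) ^ 2) ∧
      ‖deriv φ ρ₀ - (Real.log N : ℂ) / (ρ₀ * (1 - ρ₀))‖ ≤
        3 * (M / r / r) / (‖deriv riemannZeta ρ₀‖ * ‖ρ₀‖ ^ 2) + (1 + 2 * ‖ρ₀‖) / ‖ρ₀‖ ^ 4 := by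
  obtain ⟨P, V, hVo, hρ₀V, hVball, hPd, hPρ₀, hP', hPoff⟩ :=
    exists_localFactor hRH hsimp hr hr8 hρ₀ hM
  obtain ⟨d, hd, hd1, hdist⟩ := exists_dist_le ρ₀
  have hre : ρ₀.re = 1 / 2 := ntz_re hRH hρ₀
  have hρ₀0 : ρ₀ ≠ 0 := fun h ↦ by rw [h, zero_re] at hre; norm_num at hre
  have hρ₀1 : (1 - ρ₀) ≠ 0 := fun h ↦ by
    have := congrArg Complex.re h; simp [hre] at this; norm_num at this
  have hd0 : deriv riemannZeta ρ₀ ≠ 0 := ntz_deriv_ne_zero hsimp hρ₀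
  have hN0 : (N : ℂ) ≠ 0 := by exact_mod_cast (show N ≠ 0 by omega)
  have hconj : 1 - ρ₀ = conj ρ₀ := one_sub_eq_conj hRH hρ₀
  have hn1 : ‖1 - ρ₀‖ = ‖ρ₀‖ := by rw [hconj, Complex.norm_conj]
  -- the punctured sum
  set Zoff := zeroSumOff N ρ₀ with hZoff
  have hZd : DifferentiableOn ℂ Zoff (ball ρ₀ (d / 2)) :=
    differentiableOn_zeroSumOff hRH hδ hC hN ρ₀ hd hd1 hdist
  -- the neighbourhood
  set W : Set ℂ := V ∩ ball ρ₀ (d / 2) with hW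
  have hWo : IsOpen W := hVo.inter isOpen_ball
  have hρ₀W : ρ₀ ∈ W := ⟨hρ₀V, mem_ball_self (by positivity)⟩
  have hWpts : ∀ s ∈ W, s ≠ 0 ∧ (1 - s) ≠ 0 := by
    intro s hs
    have hsb := hVball hs.1
    rw [mem_ball, dist_eq_norm] at hsb
    have h := Complex.abs_re_le_norm (s - ρ₀)
    rw [sub_re, hre] at h
    have hlt : |s.re - 1 / 2| < 1 / 8 := lt_of_le_of_lt h (lt_of_lt_of_le hsb hr8)
    rw [abs_lt] at hlt
    constructor
    · intro h0; rw [h0, zero_re] at hlt; linarith [hlt.1, hlt.2]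
    · intro h0
      have : s.re = 1 := by have := congrArg Complex.re h0; simp at this; linarith
      rw [this] at hlt; linarith [hlt.1, hlt.2]
  -- the numerator
  set c₀ : ℂ := (deriv riemannZeta ρ₀)⁻¹ with hc₀
  set G : ℂ → ℂ := fun s ↦ c₀ * (N : ℂ) ^ (ρ₀ - s) + (s - ρ₀) ^ 2 * Zoff s with hG
  set φ : ℂ → ℂ := fun s ↦ P s * G s / (s * (1 - s)) with hφ
  have hGd : DifferentiableOn ℂ G W := by
    intro s hs
    refine DifferentiableAt.differentiableWithinAt ?_
    have h1 : DifferentiableAt ℂ (fun s : ℂ ↦ (N : ℂ) ^ (ρ₀ - s)) s :=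
      (((hasDerivAt_id s).const_sub ρ₀).const_cpow (Or.inl hN0)).differentiableAt
    have h2 : DifferentiableAt ℂ Zoff s := hZd.differentiableAt (isOpen_ball.mem_nhds hs.2)
    exact (h1.const_mul _).add (((differentiableAt_id.sub_const ρ₀).pow 2).mul h2)
  have hφd : DifferentiableOn ℂ φ W := by
    intro s hs
    obtain ⟨hs0, hs1⟩ := hWpts s hs
    have h1 : DifferentiableAt ℂ P s := hPd.differentiableAt (hVo.mem_nhds hs.1)
    have h2 : DifferentiableAt ℂ G s := hGd.differentiableAt (hWo.mem_nhds hs)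
    exact ((h1.mul h2).div (differentiableAt_id.mul ((differentiableAt_const _).sub
      differentiableAt_id)) (mul_ne_zero hs0 hs1)).differentiableWithinAt
  refine ⟨φ, W, hWo.mem_nhds hρ₀W, hφd, ?_, ?_⟩
  · -- the identity off `ρ₀`
    intro s hs hsρ
    obtain ⟨hs0, hs1⟩ := hWpts s hs
    obtain ⟨-, -, hPs⟩ := hPoff s hs.1 hsρ
    have hsb : ‖s - ρ₀‖ ≤ d / 2 := by
      have := hs.2; rw [mem_ball, dist_eq_norm] at this; exact this.le
    have hZ := zeroSum_eq_zeroTerm_add hRH hδ hC hN hρ₀ hd hd1 hdist hsb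
    have hsρ' : s - ρ₀ ≠ 0 := sub_ne_zero.2 hsρ
    have hρs : ρ₀ - s ≠ 0 := sub_ne_zero.2 (Ne.symm hsρ)
    rw [Psi, hZ, ← hPs]
    simp only [hφ, hG, zeroTerm, hZoff]
    rw [hc₀, show (ρ₀ - s) ^ 2 = (s - ρ₀) ^ 2 by ring]
    field_simp
  · -- the residue
    have hP : HasDerivAt P (deriv P ρ₀) ρ₀ := (hPd.differentiableAt (hVo.mem_nhds hρ₀V)).hasDerivAt
    have hZD : HasDerivAt Zoff (deriv Zoff ρ₀) ρ₀ :=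
      (hZd.differentiableAt (ball_mem_nhds _ (by positivity))).hasDerivAt
    have hcp : HasDerivAt (fun s : ℂ ↦ (N : ℂ) ^ (ρ₀ - s))
        ((N : ℂ) ^ (ρ₀ - ρ₀) * Complex.log N * (-1)) ρ₀ :=
      ((hasDerivAt_id ρ₀).const_sub ρ₀).const_cpow (Or.inl hN0)
    rw [sub_self, Complex.cpow_zero, one_mul, ← Complex.natCast_log] at hcp
    have hsq : HasDerivAt (fun s : ℂ ↦ (s - ρ₀) ^ 2) (((2 : ℕ) : ℂ) * (ρ₀ - ρ₀) ^ (2 - 1) * 1) ρ₀ :=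
      ((hasDerivAt_id ρ₀).sub_const ρ₀).fun_pow 2
    rw [sub_self] at hsq
    simp only [Nat.cast_ofNat, Nat.add_one_sub_one, pow_one, mul_zero, zero_mul] at hsq
    have hGD : HasDerivAt G (c₀ * ((Real.log N : ℂ) * (-1)) + (0 * Zoff ρ₀ + (ρ₀ - ρ₀) ^ 2 * deriv Zoff ρ₀)) ρ₀ :=
      (hcp.const_mul c₀).add (hsq.fun_mul hZD)
    have hwD : HasDerivAt (fun s : ℂ ↦ s * (1 - s)) (1 * (1 - ρ₀) + ρ₀ * (-1)) ρ₀ :=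
      (hasDerivAt_id ρ₀).fun_mul ((hasDerivAt_id ρ₀).const_sub 1)
    have hw0 : ρ₀ * (1 - ρ₀) ≠ 0 := mul_ne_zero hρ₀0 hρ₀1
    have hφD := (hP.fun_mul hGD).fun_div hwD hw0
    rw [show φ = fun s ↦ P s * G s / (s * (1 - s)) from rfl, hφD.deriv]
    have hGρ : G ρ₀ = c₀ := by simp [hG]
    rw [hGρ, hPρ₀]
    -- the algebra: the difference is `P'(ρ₀) c₀/(ρ₀(1-ρ₀)) + (1 - 2ρ₀)/(ρ₀(1-ρ₀))²`
    have key : ((deriv P ρ₀ * c₀ + -deriv riemannZeta ρ₀ *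
        (c₀ * ((Real.log N : ℂ) * -1) + (0 * Zoff ρ₀ + (ρ₀ - ρ₀) ^ 2 * deriv Zoff ρ₀))) *
        (ρ₀ * (1 - ρ₀)) - -deriv riemannZeta ρ₀ * c₀ * (1 * (1 - ρ₀) + ρ₀ * -1)) /
        (ρ₀ * (1 - ρ₀)) ^ 2 - (Real.log N : ℂ) / (ρ₀ * (1 - ρ₀)) =
        deriv P ρ₀ * c₀ / (ρ₀ * (1 - ρ₀)) + (1 - 2 * ρ₀) / (ρ₀ * (1 - ρ₀)) ^ 2 := by
      rw [hc₀]
      field_simp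
      ring
    rw [key]
    -- norms
    have hn : ‖ρ₀ * (1 - ρ₀)‖ = ‖ρ₀‖ ^ 2 := by rw [norm_mul, hn1, sq]
    have hρn : 0 < ‖ρ₀‖ := norm_pos_iff.2 hρ₀0
    have hm : 0 < ‖deriv riemannZeta ρ₀‖ := norm_pos_iff.2 hd0
    refine (norm_add_le _ _).trans (add_le_add ?_ ?_)
    · rw [norm_div, norm_mul, hn, hc₀, norm_inv]
      rw [div_le_div_iff₀ (by positivity) (by positivity)]
      have : ‖deriv P ρ₀‖ * ‖deriv riemannZeta ρ₀‖⁻¹ * (‖deriv riemannZeta ρ₀‖ * ‖ρ₀‖ ^ 2) =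
          ‖deriv P ρ₀‖ * ‖ρ₀‖ ^ 2 := by field_simp
      rw [this]
      exact mul_le_mul_of_nonneg_right hP' (by positivity)
    · rw [norm_div, norm_pow, hn, ← pow_mul]
      norm_num
      refine div_le_div_of_nonneg_right ?_ (by positivity)
      calc ‖1 - 2 * ρ₀‖ ≤ ‖(1 : ℂ)‖ + ‖2 * ρ₀‖ := norm_sub_le _ _
        _ = 1 + 2 * ‖ρ₀‖ := by simp

end BCF

end Literature.NumberTheory.LFunctions

end

noncomputable section

open Complex Filter Set Real Metric MeasureTheory
open scoped Topology ComplexConjugate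

namespace Literature.NumberTheory.LFunctions

namespace BCF

/-! ## Elementary inequalities -/

/-- `log(|y| + 2) ≤ 16 (1 + |y|)^{1/8}`. [folklore] -/
theorem log_abs_add_two_le (y : ℝ) : Real.log (|y| + 2) ≤ 16 * (1 + |y|) ^ (1 / 8 : ℝ) := by
  have h1 : Real.log (|y| + 2) ≤ (|y| + 2) ^ (1 / 8 : ℝ) / (1 / 8) :=
    Real.log_le_rpow_div (by positivity) (by norm_num)
  have h2 : (|y| + 2) ^ (1 / 8 : ℝ) ≤ (2 * (1 + |y|)) ^ (1 / 8 : ℝ) :=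
    Real.rpow_le_rpow (by positivity) (by linarith [abs_nonneg y]) (by norm_num)
  have h3 : (2 * (1 + |y|)) ^ (1 / 8 : ℝ) = 2 ^ (1 / 8 : ℝ) * (1 + |y|) ^ (1 / 8 : ℝ) :=
    Real.mul_rpow (by norm_num) (by positivity)
  have h4 : (2 : ℝ) ^ (1 / 8 : ℝ) ≤ 2 := by
    calc (2 : ℝ) ^ (1 / 8 : ℝ) ≤ 2 ^ (1 : ℝ) := Real.rpow_le_rpow_of_exponent_le (by norm_num) (by norm_num)
      _ = 2 := Real.rpow_one 2
  have h0 : 0 ≤ (1 + |y|) ^ (1 / 8 : ℝ) := by positivity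
  calc Real.log (|y| + 2) ≤ (|y| + 2) ^ (1 / 8 : ℝ) / (1 / 8) := h1
    _ = 8 * (|y| + 2) ^ (1 / 8 : ℝ) := by ring
    _ ≤ 8 * (2 * (1 + |y|) ^ (1 / 8 : ℝ)) := by rw [h3] at h2; nlinarith
    _ = 16 * (1 + |y|) ^ (1 / 8 : ℝ) := by ring

/-- `(2 + |y|)^{a} ≤ 2 (1 + |y|)^{a}` for `0 ≤ a ≤ 1`. [folklore] -/
theorem two_add_rpow_le (y : ℝ) {a : ℝ} (ha : 0 ≤ a) (ha1 : a ≤ 1) :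
    (2 + |y|) ^ a ≤ 2 * (1 + |y|) ^ a := by
  have h2 : (2 + |y|) ^ a ≤ (2 * (1 + |y|)) ^ a :=
    Real.rpow_le_rpow (by positivity) (by linarith [abs_nonneg y]) ha
  have h3 : (2 * (1 + |y|)) ^ a = 2 ^ a * (1 + |y|) ^ a := Real.mul_rpow (by norm_num) (by positivity)
  have h4 : (2 : ℝ) ^ a ≤ 2 := by
    calc (2 : ℝ) ^ a ≤ 2 ^ (1 : ℝ) := Real.rpow_le_rpow_of_exponent_le (by norm_num) ha1
      _ = 2 := Real.rpow_one 2
  have h0 : 0 ≤ (1 + |y|) ^ a := by positivity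
  rw [h3] at h2
  nlinarith

/-- On `Re s = x ∈ [7/16, 9/16]`: `‖s(1−s)‖ ≥ (1 + (Im s)²)/6`, in the form
`1/‖s (1 - s)‖ ≤ 12 (1 + |y|)^{-2}`. [folklore] -/
theorem inv_norm_mul_one_sub_le {x y : ℝ} (hx1 : 7 / 16 ≤ x) (hx2 : x ≤ 9 / 16) :
    1 / ‖((x : ℂ) + y * I) * (1 - ((x : ℂ) + y * I))‖ ≤ 12 * (1 + |y|) ^ (-(2 : ℝ)) := by
  set s : ℂ := (x : ℂ) + y * I with hs
  have hs2 : ‖s‖ ^ 2 = x ^ 2 + y ^ 2 := by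
    rw [← Complex.normSq_eq_norm_sq, Complex.normSq_apply]; simp [hs]; ring
  have hs2' : ‖1 - s‖ ^ 2 = (1 - x) ^ 2 + y ^ 2 := by
    rw [← Complex.normSq_eq_norm_sq, Complex.normSq_apply]; simp [hs]; ring
  have hprod : (1 + y ^ 2) ^ 2 / 36 ≤ ‖s * (1 - s)‖ ^ 2 := by
    rw [norm_mul, mul_pow, hs2, hs2']
    have h1 : (1 + y ^ 2) / 6 ≤ x ^ 2 + y ^ 2 := by nlinarith
    have h2 : (1 + y ^ 2) / 6 ≤ (1 - x) ^ 2 + y ^ 2 := by nlinarith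
    have h0 : 0 ≤ (1 + y ^ 2) / 6 := by positivity
    calc (1 + y ^ 2) ^ 2 / 36 = ((1 + y ^ 2) / 6) * ((1 + y ^ 2) / 6) := by ring
      _ ≤ (x ^ 2 + y ^ 2) * ((1 - x) ^ 2 + y ^ 2) := mul_le_mul h1 h2 h0 (by positivity)
  have hpos : 0 < ‖s * (1 - s)‖ := by
    have h36 : 0 < (1 + y ^ 2) ^ 2 / 36 := by positivity
    rcases (norm_nonneg (s * (1 - s))).eq_or_lt with h' | h'
    · rw [← h'] at hprod; norm_num at hprod; nlinarith [sq_nonneg y]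
    · exact h'
  have hlow : (1 + y ^ 2) / 6 ≤ ‖s * (1 - s)‖ := by
    have h0 : 0 ≤ (1 + y ^ 2) / 6 := by positivity
    nlinarith [hprod, norm_nonneg (s * (1 - s))]
  have hu : (1 + |y|) ^ (-(2 : ℝ)) = 1 / (1 + |y|) ^ 2 := by
    rw [Real.rpow_neg (by positivity), one_div]; norm_cast
  rw [hu, div_le_iff₀ hpos]
  have hsq : (1 + |y|) ^ 2 ≤ 2 * (1 + y ^ 2) := by nlinarith [sq_abs y, abs_nonneg y, sq_nonneg (|y| - 1)]
  have h12 : (1 : ℝ) ≤ 12 * (1 / (1 + |y|) ^ 2) * ((1 + y ^ 2) / 6) := by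
    rw [mul_one_div, div_mul_eq_mul_div, le_div_iff₀ (by positivity)]
    nlinarith
  calc (1 : ℝ) ≤ 12 * (1 / (1 + |y|) ^ 2) * ((1 + y ^ 2) / 6) := h12
    _ ≤ 12 * (1 / (1 + |y|) ^ 2) * ‖s * (1 - s)‖ := mul_le_mul_of_nonneg_left hlow (by positivity)

/-! ## `Z_N` on the lines and on good-height horizontals (tsum forms of Lemma 3) -/

/-- From finite-sum bounds to the tsum: if all finite partial sums of `1/(|ζ'(ρ)||ρ−s|²)` over
distinct zeros are `≤ B`, the family is summable and `‖Z_N(s)‖ ≤ N^{1/2−Re s} B`. [folklore] -/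
theorem norm_zeroSum_le_of_sum_le (hRH : RiemannHypothesis) {N : ℕ} (hN : 2 ≤ N) {s : ℂ} {B : ℝ}
    (hB : ∀ F : Finset ℂ, (∀ ρ ∈ F, ρ ∈ ZetaZeros.riemannZetaNontrivialZeros) →
      ∑ ρ ∈ F, 1 / (‖deriv riemannZeta ρ‖ * ‖ρ - s‖ ^ 2) ≤ B) :
    ‖zeroSum N s‖ ≤ (N : ℝ) ^ (1 / 2 - s.re) * B := by
  classical
  set f : ℂ → ℝ := fun ρ ↦ 1 / (‖deriv riemannZeta ρ‖ * ‖ρ - s‖ ^ 2) with hf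
  have hf0 : ∀ ρ, 0 ≤ f ρ := fun ρ ↦ by rw [hf]; positivity
  have hpart : ∀ u : Finset ZetaZeros.riemannZetaNontrivialZeros, ∑ x ∈ u, f x ≤ B := by
    intro u
    set F : Finset ℂ := u.map (Function.Embedding.subtype _) with hF
    have hsumF : ∑ x ∈ u, f (x : ℂ) = ∑ ρ ∈ F, f ρ := by rw [hF, Finset.sum_map]; rfl
    rw [hsumF]
    refine hB F fun ρ hρ ↦ ?_
    rw [hF, Finset.mem_map] at hρ
    obtain ⟨x, -, rfl⟩ := hρ
    exact x.2
  have hsum : Summable fun ρ : ZetaZeros.riemannZetaNontrivialZeros ↦ f ρ :=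
    summable_of_sum_le (fun ρ ↦ hf0 ρ) hpart
  have htsum : ∑' ρ : ZetaZeros.riemannZetaNontrivialZeros, f ρ ≤ B := hsum.tsum_le_of_sum_le hpart
  exact (norm_zeroSum_le hRH hN hsum).trans
    (mul_le_mul_of_nonneg_left htsum (Real.rpow_nonneg (Nat.cast_nonneg N) _))

/-! ## `Ψ_N` on the lines `Re s = 1/2 ± ε` -/

/-- **`Ψ_N` on the lines.** Under RH, simple zeros and (2) (`0 < δ ≤ 1`), for `0 < ε ≤ 1/16` there is
`K > 0` with `‖Ψ_N(x + iy)‖ ≤ K N^{1/2−x} (1 + |y|)^{−(9/8 − 2ε + δ/4)}` for all `N ≥ 2`, all `x`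
with `|x − 1/2| = ε` and all real `y`. [cite: BettinConreyFarmer2013, §3, proof of Thm. 1] -/
theorem exists_norm_Psi_line_le (hRH : RiemannHypothesis)
    (hsimp : ∀ ρ : ℂ, riemannZeta ρ = 0 → 0 < ρ.re → ρ.re < 1 → deriv riemannZeta ρ ≠ 0)
    {δ C : ℝ} (hδ : 0 < δ) (hδ1 : δ ≤ 1)
    (hC : ∀ T : ℝ, 2 ≤ T →
      ∑ᶠ ρ ∈ zetaZeroBox 0 T, 1 / ‖deriv riemannZeta ρ‖ ^ 2 ≤ C * T ^ (3 / 2 - δ))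
    {ε : ℝ} (hε : 0 < ε) (hε16 : ε ≤ 1 / 16) :
    ∃ K : ℝ, 0 < K ∧ ∀ N : ℕ, 2 ≤ N → ∀ x : ℝ, |x - 1 / 2| = ε → ∀ y : ℝ,
      ‖Psi N (x + y * I)‖ ≤ K * (N : ℝ) ^ (1 / 2 - x) * (1 + |y|) ^ (-(9 / 8 - 2 * ε + δ / 4)) := by
  obtain ⟨Cl, hCl0, hCl⟩ := exists_norm_logDeriv_line_le hRH hε (by linarith)
  obtain ⟨Cs, hCs0, hCs⟩ := exists_norm_zeta_le_strip hRH hε (by linarith)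
  obtain ⟨K₃, hK₃0, hK₃⟩ := exists_lemma3 hRH hsimp hδ hδ1 hC
  refine ⟨Cl * 16 * (Cs * 2) * (K₃ * ε⁻¹ ^ 2) * 12, by positivity, fun N hN x hx y ↦ ?_⟩
  have hxI : 7 / 16 ≤ x ∧ x ≤ 9 / 16 := by
    have := abs_le.1 (le_of_eq hx); constructor <;> linarith [this.1, this.2]
  set s : ℂ := (x : ℂ) + y * I with hs
  have hsre : s.re = x := by simp [hs]
  have hsim : s.im = y := by simp [hs]
  set u : ℝ := 1 + |y| with hu
  have hu1 : 1 ≤ u := by rw [hu]; linarith [abs_nonneg y]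
  have hu0 : 0 < u := by linarith
  -- the four factors
  have h1 : ‖deriv riemannZeta (1 - s) / riemannZeta (1 - s)‖ ≤ Cl * (16 * u ^ (1 / 8 : ℝ)) := by
    have e : (1 : ℂ) - s = ((1 - x : ℝ) : ℂ) + ((-y : ℝ) : ℂ) * I := by rw [hs]; push_cast; ring
    have hx' : (1 - x) ∈ Icc (1 / 4 : ℝ) (3 / 4) := ⟨by linarith, by linarith⟩
    have hd : ε ≤ |(1 - x) - 1 / 2| := by
      rw [show (1 - x) - 1 / 2 = -(x - 1 / 2) by ring, abs_neg, hx]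
    have := (hCl (1 - x) (-y) hx' hd).2
    rw [← e, abs_neg] at this
    exact this.trans (mul_le_mul_of_nonneg_left (log_abs_add_two_le y) hCl0.le)
  have h2 : ‖riemannZeta s‖ ≤ Cs * (2 * u ^ (2 * ε)) := by
    have := hCs s (by rw [hsre]; have := abs_le.1 (le_of_eq hx); linarith [this.1])
      (by rw [hsre]; have := abs_le.1 (le_of_eq hx); linarith [this.2])
    rw [hsim] at this
    exact this.trans (mul_le_mul_of_nonneg_left (two_add_rpow_le y (by linarith) (by linarith)) hCs0.le)
  have h3 : ‖zeroSum N s‖ ≤ (N : ℝ) ^ (1 / 2 - x) * (K₃ * ε⁻¹ ^ 2 * u ^ (3 / 4 - δ / 4)) := by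
    have hB := hK₃ ε hε (by linarith) s (by rw [hsre, hx]) (by rw [hsre, hx]; linarith)
    rw [hsim] at hB
    have := norm_zeroSum_le_of_sum_le hRH hN hB
    rwa [hsre] at this
  have h4 : 1 / ‖s * (1 - s)‖ ≤ 12 * u ^ (-(2 : ℝ)) := inv_norm_mul_one_sub_le hxI.1 hxI.2
  -- combine
  have hnn3 : 0 ≤ (N : ℝ) ^ (1 / 2 - x) * (K₃ * ε⁻¹ ^ 2 * u ^ (3 / 4 - δ / 4)) := by positivity
  rw [Psi, norm_div, div_eq_mul_one_div]
  calc ‖deriv riemannZeta (1 - s) / riemannZeta (1 - s) * riemannZeta s * zeroSum N s‖ * (1 / ‖s * (1 - s)‖)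
      ≤ (Cl * (16 * u ^ (1 / 8 : ℝ)) * (Cs * (2 * u ^ (2 * ε))) *
          ((N : ℝ) ^ (1 / 2 - x) * (K₃ * ε⁻¹ ^ 2 * u ^ (3 / 4 - δ / 4)))) * (12 * u ^ (-(2 : ℝ))) := by
        refine mul_le_mul ?_ h4 (by positivity) (by positivity)
        rw [norm_mul, norm_mul]
        exact mul_le_mul (mul_le_mul h1 h2 (norm_nonneg _) (by positivity)) h3 (norm_nonneg _)
          (by positivity)
    _ = Cl * 16 * (Cs * 2) * (K₃ * ε⁻¹ ^ 2) * 12 * (N : ℝ) ^ (1 / 2 - x) *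
          (u ^ (1 / 8 : ℝ) * u ^ (2 * ε) * u ^ (3 / 4 - δ / 4) * u ^ (-(2 : ℝ))) := by ring
    _ = Cl * 16 * (Cs * 2) * (K₃ * ε⁻¹ ^ 2) * 12 * (N : ℝ) ^ (1 / 2 - x) *
          u ^ (-(9 / 8 - 2 * ε + δ / 4)) := by
        rw [← Real.rpow_add hu0, ← Real.rpow_add hu0, ← Real.rpow_add hu0]; ring_nf

/-- Continuity of `y ↦ Ψ_N(x + iy)` on a line `Re s = x ∈ [1/4, 3/4]`, `x ≠ 1/2` (no zeros there under RH).
[folklore] -/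
theorem continuous_Psi_line (hRH : RiemannHypothesis) {δ C : ℝ} (hδ : 0 < δ)
    (hC : ∀ T : ℝ, 2 ≤ T →
      ∑ᶠ ρ ∈ zetaZeroBox 0 T, 1 / ‖deriv riemannZeta ρ‖ ^ 2 ≤ C * T ^ (3 / 2 - δ))
    {N : ℕ} (hN : 2 ≤ N) {x : ℝ} (hx1 : 1 / 4 ≤ x) (hx2 : x ≤ 3 / 4) (hx : x ≠ 1 / 2) :
    Continuous fun y : ℝ ↦ Psi N (x + y * I) := by
  refine continuous_iff_continuousAt.2 fun y ↦ ?_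
  have hz : ((x : ℂ) + y * I) ∉ ZetaZeros.riemannZetaNontrivialZeros := fun h ↦ by
    have := ntz_re hRH h; simp at this; exact hx (by rw [this]; norm_num)
  exact (analyticAt_Psi hRH hδ hC hN (by simpa using hx1) (by simpa using hx2) hz).continuousAt.comp
    (f := fun y : ℝ ↦ (x : ℂ) + y * I) (by fun_prop)

/-- **Integrability of `Ψ_N` on the lines `Re s = 1/2 ± ε` and the size of the integral**:
`‖∫ Ψ_N(x + iy) dy‖ ≤ K' N^{1/2 − x}` with `K'` independent of `N` and of the sign.
[cite: BettinConreyFarmer2013, §3, proof of Thm. 1] -/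
theorem exists_integral_Psi_line (hRH : RiemannHypothesis)
    (hsimp : ∀ ρ : ℂ, riemannZeta ρ = 0 → 0 < ρ.re → ρ.re < 1 → deriv riemannZeta ρ ≠ 0)
    {δ C : ℝ} (hδ : 0 < δ) (hδ1 : δ ≤ 1)
    (hC : ∀ T : ℝ, 2 ≤ T →
      ∑ᶠ ρ ∈ zetaZeroBox 0 T, 1 / ‖deriv riemannZeta ρ‖ ^ 2 ≤ C * T ^ (3 / 2 - δ))
    {ε : ℝ} (hε : 0 < ε) (hε16 : ε ≤ 1 / 16) :
    ∃ K' : ℝ, 0 < K' ∧ ∀ N : ℕ, 2 ≤ N → ∀ x : ℝ, |x - 1 / 2| = ε →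
      Integrable (fun y : ℝ ↦ Psi N (x + y * I)) ∧
      ‖∫ y : ℝ, Psi N (x + y * I)‖ ≤ K' * (N : ℝ) ^ (1 / 2 - x) := by
  obtain ⟨K, hK0, hK⟩ := exists_norm_Psi_line_le hRH hsimp hδ hδ1 hC hε hε16
  set q : ℝ := 9 / 8 - 2 * ε + δ / 4 with hq
  have hq1 : (Module.finrank ℝ ℝ : ℝ) < q := by rw [Module.finrank_self]; norm_num; rw [hq]; linarith
  have hint : Integrable fun y : ℝ ↦ (1 + ‖y‖) ^ (-q) := integrable_one_add_norm hq1
  set Iq : ℝ := ∫ y : ℝ, (1 + ‖y‖) ^ (-q) with hIq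
  have hIq0 : 0 ≤ Iq := integral_nonneg fun y ↦ by positivity
  refine ⟨K * Iq + 1, by positivity, fun N hN x hx ↦ ?_⟩
  have hxI : 1 / 4 ≤ x ∧ x ≤ 3 / 4 ∧ x ≠ 1 / 2 := by
    have := abs_le.1 (le_of_eq hx)
    refine ⟨by linarith [this.1], by linarith [this.2], fun h ↦ ?_⟩
    rw [h, sub_self, abs_zero] at hx; linarith
  have hbound : ∀ y : ℝ, ‖Psi N (x + y * I)‖ ≤ K * (N : ℝ) ^ (1 / 2 - x) * (1 + ‖y‖) ^ (-q) := by
    intro y; rw [Real.norm_eq_abs]; exact hK N hN x hx y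
  have hcont := continuous_Psi_line hRH hδ hC hN hxI.1 hxI.2.1 hxI.2.2
  have hI : Integrable fun y : ℝ ↦ Psi N (x + y * I) :=
    (hint.const_mul (K * (N : ℝ) ^ (1 / 2 - x))).mono' hcont.aestronglyMeasurable
      (Eventually.of_forall hbound)
  refine ⟨hI, ?_⟩
  have hNp : 0 ≤ (N : ℝ) ^ (1 / 2 - x) := Real.rpow_nonneg (Nat.cast_nonneg N) _
  calc ‖∫ y : ℝ, Psi N (x + y * I)‖ ≤ ∫ y : ℝ, K * (N : ℝ) ^ (1 / 2 - x) * (1 + ‖y‖) ^ (-q) :=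
        norm_integral_le_of_norm_le (hint.const_mul _) (Eventually.of_forall hbound)
    _ = K * (N : ℝ) ^ (1 / 2 - x) * Iq := by rw [integral_const_mul]
    _ ≤ (K * Iq + 1) * (N : ℝ) ^ (1 / 2 - x) := by nlinarith

/-! ## `Ψ_N` on horizontal segments at good heights -/

/-- A good height `T` is also good at `−T` (the zeros are symmetric under conjugation). [folklore] -/
theorem goodHeight_neg {c₀ T : ℝ} (h : ∀ ρ ∈ zetaZerosRight, c₀ / Real.log (|T| + 2) ≤ |ρ.im - T|) :
    ∀ ρ ∈ zetaZerosRight, c₀ / Real.log (|-T| + 2) ≤ |ρ.im - -T| := by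
  intro ρ hρ
  have hc : conj ρ ∈ zetaZerosRight := by
    refine ⟨?_, by simpa using hρ.2⟩
    rw [riemannZeta_conj, hρ.1, map_zero]
  have := h (conj ρ) hc
  rw [Complex.conj_im] at this
  rw [abs_neg, show ρ.im - -T = -(-ρ.im - T) by ring, abs_neg]
  exact this

/-- **`Ψ_N` on the horizontal segments `Im s = ±T`, `|Re s − 1/2| ≤ ε`, at a good height `T ≥ 2`:**
`‖Ψ_N(s)‖ ≤ K N^{ε} T^{−1/8}` (under RH, simple zeros and (2); `0 < ε ≤ 1/16`).
[cite: BettinConreyFarmer2013, §3, proof of Thm. 1] -/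
theorem exists_norm_Psi_horizontal_le (hRH : RiemannHypothesis)
    (hsimp : ∀ ρ : ℂ, riemannZeta ρ = 0 → 0 < ρ.re → ρ.re < 1 → deriv riemannZeta ρ ≠ 0)
    {δ C : ℝ} (hδ : 0 < δ)
    (hC : ∀ T : ℝ, 2 ≤ T →
      ∑ᶠ ρ ∈ zetaZeroBox 0 T, 1 / ‖deriv riemannZeta ρ‖ ^ 2 ≤ C * T ^ (3 / 2 - δ))
    {ε : ℝ} (hε : 0 < ε) (hε16 : ε ≤ 1 / 16) {c₀ : ℝ} (hc₀ : 0 < c₀) :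
    ∃ K : ℝ, 0 < K ∧ ∀ N : ℕ, 2 ≤ N → ∀ T : ℝ, 2 ≤ T →
      (∀ ρ ∈ zetaZerosRight, c₀ / Real.log (|T| + 2) ≤ |ρ.im - T|) →
      ∀ x ∈ Icc (1 / 2 - ε) (1 / 2 + ε), ∀ σ : ℝ, (σ = 1 ∨ σ = -1) →
        ‖Psi N (x + (σ * T) * I)‖ ≤ K * (N : ℝ) ^ ε * T ^ (-(1 / 8 : ℝ)) := by
  obtain ⟨Cg, hCg0, hCg⟩ := norm_logDeriv_zeta_le_of_goodHeight hRH hc₀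
  obtain ⟨Cs, hCs0, hCs⟩ := exists_norm_zeta_le_strip hRH hε (by linarith)
  obtain ⟨Kh, hKh0, hKh⟩ := exists_sum_horizontal_le hRH hsimp hδ hC hc₀
  refine ⟨Cg * 1024 * (Cs * 2) * Kh, by positivity, fun N hN T hT hgood x hx σ hσ ↦ ?_⟩
  have hT0 : 0 < T := by linarith
  have hN1 : (1 : ℝ) ≤ N := by exact_mod_cast (show 1 ≤ N by omega)
  set s : ℂ := (x : ℂ) + (σ * T) * I with hs
  have hsre : s.re = x := by simp [hs]
  have hsim : s.im = σ * T := by simp [hs]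
  have habsim : |s.im| = T := by
    rw [hsim]; rcases hσ with rfl | rfl <;> simp [abs_of_pos hT0]
  have hσT : |σ * T| = T := by rw [← hsim]; exact habsim
  -- goodness at `σ T` and at `-σ T`
  have hgoodσ : ∀ τ : ℝ, (τ = T ∨ τ = -T) →
      ∀ ρ ∈ zetaZerosRight, c₀ / Real.log (|τ| + 2) ≤ |ρ.im - τ| := by
    rintro τ (rfl | rfl)
    · exact hgood
    · exact goodHeight_neg hgood
  have hστ : (σ * T = T ∨ σ * T = -T) ∧ (-(σ * T) = T ∨ -(σ * T) = -T) := by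
    rcases hσ with rfl | rfl <;> simp
  -- factor 1: `ζ'/ζ(1 - s)` at height `-σT`: `≤ Cg log²(T+2) ≤ Cg · 1024 T^{1/8}`
  have hlogsq : Real.log (T + 2) ^ 2 ≤ 1024 * T ^ (1 / 8 : ℝ) := by
    have hl0 : 0 ≤ Real.log (T + 2) := Real.log_nonneg (by linarith)
    have hl' : Real.log (T + 2) ≤ (T + 2) ^ (1 / 16 : ℝ) / (1 / 16) :=
      Real.log_le_rpow_div (by linarith) (by norm_num)
    have h3T : (T + 2) ^ (1 / 16 : ℝ) ≤ 2 * T ^ (1 / 16 : ℝ) := by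
      calc (T + 2) ^ (1 / 16 : ℝ) ≤ (2 * T) ^ (1 / 16 : ℝ) :=
            Real.rpow_le_rpow (by linarith) (by linarith) (by norm_num)
        _ = 2 ^ (1 / 16 : ℝ) * T ^ (1 / 16 : ℝ) := Real.mul_rpow (by norm_num) hT0.le
        _ ≤ 2 * T ^ (1 / 16 : ℝ) := by
            refine mul_le_mul_of_nonneg_right ?_ (Real.rpow_nonneg hT0.le _)
            calc (2 : ℝ) ^ (1 / 16 : ℝ) ≤ 2 ^ (1 : ℝ) :=
                  Real.rpow_le_rpow_of_exponent_le (by norm_num) (by norm_num)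
              _ = 2 := Real.rpow_one 2
    have hl'' : Real.log (T + 2) ≤ 32 * T ^ (1 / 16 : ℝ) := by
      have := hl'.trans (div_le_div_of_nonneg_right h3T (by norm_num)); linarith
    have hT16 : T ^ (1 / 16 : ℝ) * T ^ (1 / 16 : ℝ) = T ^ (1 / 8 : ℝ) := by
      rw [← Real.rpow_add hT0]; norm_num
    calc Real.log (T + 2) ^ 2 ≤ (32 * T ^ (1 / 16 : ℝ)) ^ 2 := pow_le_pow_left₀ hl0 hl'' 2
      _ = 1024 * (T ^ (1 / 16 : ℝ) * T ^ (1 / 16 : ℝ)) := by ring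
      _ = 1024 * T ^ (1 / 8 : ℝ) := by rw [hT16]
  have h1 : ‖deriv riemannZeta (1 - s) / riemannZeta (1 - s)‖ ≤ Cg * (1024 * T ^ (1 / 8 : ℝ)) := by
    have e : (1 : ℂ) - s = ((1 - x : ℝ) : ℂ) + ((-(σ * T) : ℝ) : ℂ) * I := by rw [hs]; push_cast; ring
    have hx' : (1 - x) ∈ Icc (1 / 4 : ℝ) 2 := ⟨by linarith [hx.2], by linarith [hx.1]⟩
    have habs : |(-(σ * T))| = T := by rw [abs_neg, hσT]
    have h := (hCg (-(σ * T)) (by rw [habs]; exact hT) (by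
      have := hgoodσ (-(σ * T)) hστ.2; rwa [habs] at this ⊢) (1 - x) hx').2
    rw [← e, habs] at h
    exact h.trans (mul_le_mul_of_nonneg_left hlogsq hCg0.le)
  -- factor 2: `ζ(s)`
  have h2 : ‖riemannZeta s‖ ≤ Cs * (2 * T ^ (2 * ε)) := by
    have h := hCs s (by rw [hsre]; exact hx.1) (by rw [hsre]; exact hx.2)
    rw [habsim] at h
    refine h.trans (mul_le_mul_of_nonneg_left ?_ hCs0.le)
    calc (2 + T) ^ (2 * ε) ≤ (2 * T) ^ (2 * ε) :=
          Real.rpow_le_rpow (by linarith) (by linarith) (by linarith)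
      _ = 2 ^ (2 * ε) * T ^ (2 * ε) := Real.mul_rpow (by norm_num) hT0.le
      _ ≤ 2 * T ^ (2 * ε) := by
          refine mul_le_mul_of_nonneg_right ?_ (Real.rpow_nonneg hT0.le _)
          calc (2 : ℝ) ^ (2 * ε) ≤ 2 ^ (1 : ℝ) :=
                Real.rpow_le_rpow_of_exponent_le (by norm_num) (by linarith)
            _ = 2 := Real.rpow_one 2
  -- factor 3: `Z_N(s)`
  have h3 : ‖zeroSum N s‖ ≤ (N : ℝ) ^ ε * (Kh * T ^ (3 / 2 : ℝ)) := by
    have hB : ∀ F : Finset ℂ, (∀ ρ ∈ F, ρ ∈ ZetaZeros.riemannZetaNontrivialZeros) →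
        ∑ ρ ∈ F, 1 / (‖deriv riemannZeta ρ‖ * ‖ρ - s‖ ^ 2) ≤ Kh * |σ * T| ^ (3 / 2 : ℝ) := by
      intro F hF
      have h := hKh (σ * T) (by rw [hσT]; exact hT) (fun ρ hρ ↦ by
        have hρR : ρ ∈ zetaZerosRight :=
          ⟨ZetaZeros.riemannZetaNontrivialZeros.zeta_eq_zero hρ, by rw [ntz_re hRH hρ]; norm_num⟩
        exact hgoodσ (σ * T) hστ.1 ρ hρR) x F hF
      simpa [hs] using h
    have := norm_zeroSum_le_of_sum_le hRH hN hB
    rw [hsre, hσT] at this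
    refine this.trans (mul_le_mul_of_nonneg_right ?_ (by positivity))
    exact Real.rpow_le_rpow_of_exponent_le hN1 (by linarith [hx.1])
  -- factor 4: `1/|s(1-s)| ≤ T⁻²`
  have h4 : 1 / ‖s * (1 - s)‖ ≤ 1 / T ^ 2 := by
    have hs1 : T ≤ ‖s‖ := by
      have := Complex.abs_im_le_norm s; rwa [habsim] at this
    have hs2 : T ≤ ‖1 - s‖ := by
      have := Complex.abs_im_le_norm (1 - s)
      rwa [sub_im, one_im, zero_sub, abs_neg, habsim] at this
    rw [norm_mul]
    exact div_le_div_of_nonneg_left zero_le_one (by positivity)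
      (by rw [sq]; exact mul_le_mul hs1 hs2 hT0.le (norm_nonneg _))
  -- combine
  rw [Psi, norm_div, div_eq_mul_one_div]
  have hprod : ‖deriv riemannZeta (1 - s) / riemannZeta (1 - s) * riemannZeta s * zeroSum N s‖ ≤
      (Cg * (1024 * T ^ (1 / 8 : ℝ))) * (Cs * (2 * T ^ (2 * ε))) * ((N : ℝ) ^ ε * (Kh * T ^ (3 / 2 : ℝ))) := by
    rw [norm_mul, norm_mul]
    exact mul_le_mul (mul_le_mul h1 h2 (norm_nonneg _) (by positivity)) h3 (norm_nonneg _) (by positivity)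
  have hTe : T ^ (1 / 8 : ℝ) * T ^ (2 * ε) * T ^ (3 / 2 : ℝ) * (1 / T ^ 2) = T ^ (-(3 / 8 - 2 * ε)) := by
    rw [show (1 / T ^ 2 : ℝ) = T ^ (-(2 : ℝ)) by
      rw [Real.rpow_neg hT0.le, one_div]; norm_cast,
      ← Real.rpow_add hT0, ← Real.rpow_add hT0, ← Real.rpow_add hT0]
    ring_nf
  have hTle : T ^ (-(3 / 8 - 2 * ε)) ≤ T ^ (-(1 / 8 : ℝ)) :=
    Real.rpow_le_rpow_of_exponent_le (by linarith) (by linarith)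
  calc ‖deriv riemannZeta (1 - s) / riemannZeta (1 - s) * riemannZeta s * zeroSum N s‖ * (1 / ‖s * (1 - s)‖)
      ≤ ((Cg * (1024 * T ^ (1 / 8 : ℝ))) * (Cs * (2 * T ^ (2 * ε))) * ((N : ℝ) ^ ε * (Kh * T ^ (3 / 2 : ℝ)))) *
          (1 / T ^ 2) := mul_le_mul hprod h4 (by positivity) (by positivity)
    _ = Cg * 1024 * (Cs * 2) * Kh * (N : ℝ) ^ ε *
          (T ^ (1 / 8 : ℝ) * T ^ (2 * ε) * T ^ (3 / 2 : ℝ) * (1 / T ^ 2)) := by ring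
    _ = Cg * 1024 * (Cs * 2) * Kh * (N : ℝ) ^ ε * T ^ (-(3 / 8 - 2 * ε)) := by rw [hTe]
    _ ≤ Cg * 1024 * (Cs * 2) * Kh * (N : ℝ) ^ ε * T ^ (-(1 / 8 : ℝ)) :=
        mul_le_mul_of_nonneg_left hTle (by positivity)

end BCF

end Literature.NumberTheory.LFunctions

end

noncomputable section

open Complex Filter Set Real Metric MeasureTheory
open scoped Topology ComplexConjugate

namespace Literature.NumberTheory.LFunctions

namespace BCF

/-! ## Two summable families over the zeros -/

/-- Under RH, `∑_ρ 1/‖ρ‖²` over the distinct non-trivial zeros converges (from the tree's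
`∑ m(ρ)/|ρ|² = 2 + γ − log 4π`). [cite: MontgomeryVaughan2007, Thm. 10.13] -/
theorem summable_inv_norm_sq (hRH : RiemannHypothesis) :
    Summable fun ρ : ZetaZeros.riemannZetaNontrivialZeros ↦ 1 / ‖(ρ : ℂ)‖ ^ 2 := by
  have h : Summable fun ρ : ZetaZeros.riemannZetaNontrivialZeros ↦
      (riemannZetaZeroOrder (ρ : ℂ) : ℝ) / ‖(ρ : ℂ)‖ ^ 2 :=
    (hasSum_zeroOrder_div_norm_sq_of_RH hRH).summable
  refine Summable.of_nonneg_of_le (fun ρ ↦ by positivity) (fun ρ ↦ ?_) h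
  have h0 := (ZetaZeros.riemannZetaNontrivialZeros.mem_iff'.1 ρ.2).1
  have hm : (1 : ℝ) ≤ riemannZetaZeroOrder (ρ : ℂ) := by
    exact_mod_cast (riemannZetaZeroOrder_pos_iff (ne_one_of_riemannZeta_eq_zero h0)).2 h0
  exact div_le_div_of_nonneg_right hm (sq_nonneg _)

/-- The error weight of the residues: `Err(ρ) = 768 M(ρ)/(|ζ'(ρ)| |ρ|²) + (1 + 2|ρ|)/|ρ|⁴` with
`M(ρ) = C (3 + |Im ρ|)^{1/4}`, and its summability under RH and (2).
[cite: BettinConreyFarmer2013, §3, proof of Thm. 1 (last display)] -/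
theorem summable_err (hRH : RiemannHypothesis) {δ C : ℝ} (hδ : 0 < δ)
    (hC : ∀ T : ℝ, 2 ≤ T →
      ∑ᶠ ρ ∈ zetaZeroBox 0 T, 1 / ‖deriv riemannZeta ρ‖ ^ 2 ≤ C * T ^ (3 / 2 - δ))
    {Cs : ℝ} (hCs0 : 0 < Cs) :
    Summable fun ρ : ZetaZeros.riemannZetaNontrivialZeros ↦
      3 * (Cs * (3 + |(ρ : ℂ).im|) ^ (1 / 4 : ℝ) / (1 / 16) / (1 / 16)) /
        (‖deriv riemannZeta ρ‖ * ‖(ρ : ℂ)‖ ^ 2) + (1 + 2 * ‖(ρ : ℂ)‖) / ‖(ρ : ℂ)‖ ^ 4 := by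
  have h1 := summable_inv_deriv_mul_norm_rpow hRH hδ hC (α := 7 / 4) (by norm_num) (by linarith)
  have h2 := summable_inv_norm_sq hRH
  refine Summable.add ?_ ?_
  · refine Summable.of_nonneg_of_le (fun ρ ↦ by positivity) (fun ρ ↦ ?_) (h1.mul_left (768 * Cs * 2))
    have hρ := ρ.2
    have hn : 1 / 2 ≤ ‖(ρ : ℂ)‖ := ntz_half_le_norm hRH hρ
    have hnpos : 0 < ‖(ρ : ℂ)‖ := by linarith
    have him : |(ρ : ℂ).im| ≤ ‖(ρ : ℂ)‖ := Complex.abs_im_le_norm _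
    have h3 : (3 + |(ρ : ℂ).im|) ^ (1 / 4 : ℝ) ≤ 2 * ‖(ρ : ℂ)‖ ^ (1 / 4 : ℝ) := by
      calc (3 + |(ρ : ℂ).im|) ^ (1 / 4 : ℝ) ≤ (16 * ‖(ρ : ℂ)‖) ^ (1 / 4 : ℝ) :=
            Real.rpow_le_rpow (by positivity) (by linarith) (by norm_num)
        _ = 16 ^ (1 / 4 : ℝ) * ‖(ρ : ℂ)‖ ^ (1 / 4 : ℝ) := Real.mul_rpow (by norm_num) hnpos.le
        _ = 2 * ‖(ρ : ℂ)‖ ^ (1 / 4 : ℝ) := by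
            rw [show (16 : ℝ) = 2 ^ (4 : ℝ) by norm_num, ← Real.rpow_mul (by norm_num)]; norm_num
    rcases (norm_nonneg (deriv riemannZeta ρ)).eq_or_lt with hd | hd
    · rw [← hd]; simp
    · have e : (768 * Cs * 2) * (1 / (‖deriv riemannZeta ρ‖ * ‖(ρ : ℂ)‖ ^ (7 / 4 : ℝ))) =
          3 * (Cs * (2 * ‖(ρ : ℂ)‖ ^ (1 / 4 : ℝ)) / (1 / 16) / (1 / 16)) /
            (‖deriv riemannZeta ρ‖ * ‖(ρ : ℂ)‖ ^ 2) := by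
        have h74 : ‖(ρ : ℂ)‖ ^ (2 : ℕ) = ‖(ρ : ℂ)‖ ^ (7 / 4 : ℝ) * ‖(ρ : ℂ)‖ ^ (1 / 4 : ℝ) := by
          rw [← Real.rpow_add hnpos, ← Real.rpow_natCast]; norm_num
        rw [h74]
        field_simp
        ring
      rw [e]
      refine div_le_div_of_nonneg_right ?_ (by positivity)
      have : 0 ≤ Cs := hCs0.le
      gcongr
  · refine Summable.of_nonneg_of_le (fun ρ ↦ by positivity) (fun ρ ↦ ?_) (h2.mul_left 8)
    have hn : 1 / 2 ≤ ‖(ρ : ℂ)‖ := ntz_half_le_norm hRH ρ.2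
    have hnpos : 0 < ‖(ρ : ℂ)‖ := by linarith
    rw [mul_one_div, div_le_div_iff₀ (by positivity) (by positivity)]
    have h4 : ‖(ρ : ℂ)‖ ^ 4 = ‖(ρ : ℂ)‖ ^ 2 * ‖(ρ : ℂ)‖ ^ 2 := by ring
    rw [h4]
    have : 0 ≤ ‖(ρ : ℂ)‖ ^ 2 := sq_nonneg _
    nlinarith [mul_le_mul_of_nonneg_left hn this]

/-! ## The residues of `Ψ_N` -/

/-- **Pole data and residues of `Ψ_N` at all the zeros, with the uniform error weight.** Under RH,
simple zeros and (2), for `N ≥ 2`: at every non-trivial zero `ρ`, `Ψ_N = φ_ρ/(s−ρ)²` near `ρ` with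
`‖φ_ρ'(ρ) − log N/(ρ(1−ρ))‖ ≤ Err(ρ)`, where `Err` (summable, `BCF.summable_err`) does not depend
on `N`. [cite: BettinConreyFarmer2013, §3, proof of Thm. 1 (last display)] -/
theorem exists_poleData_all (hRH : RiemannHypothesis)
    (hsimp : ∀ ρ : ℂ, riemannZeta ρ = 0 → 0 < ρ.re → ρ.re < 1 → deriv riemannZeta ρ ≠ 0)
    {δ C : ℝ} (hδ : 0 < δ)
    (hC : ∀ T : ℝ, 2 ≤ T →
      ∑ᶠ ρ ∈ zetaZeroBox 0 T, 1 / ‖deriv riemannZeta ρ‖ ^ 2 ≤ C * T ^ (3 / 2 - δ))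
    {Cs : ℝ} (hCs : ∀ u : ℂ, 1 / 2 - 1 / 8 ≤ u.re → u.re ≤ 1 / 2 + 1 / 8 →
      ‖riemannZeta u‖ ≤ Cs * (2 + |u.im|) ^ (2 * (1 / 8 : ℝ)))
    {N : ℕ} (hN : 2 ≤ N) {ρ₀ : ℂ} (hρ₀ : ρ₀ ∈ ZetaZeros.riemannZetaNontrivialZeros) :
    ∃ φ : ℂ → ℂ, ∃ W ∈ 𝓝 ρ₀, DifferentiableOn ℂ φ W ∧
      (∀ s ∈ W, s ≠ ρ₀ → Psi N s = φ s / (s - ρ₀) ^ 2) ∧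
      ‖deriv φ ρ₀ - (Real.log N : ℂ) / (ρ₀ * (1 - ρ₀))‖ ≤
        3 * (Cs * (3 + |ρ₀.im|) ^ (1 / 4 : ℝ) / (1 / 16) / (1 / 16)) /
          (‖deriv riemannZeta ρ₀‖ * ‖ρ₀‖ ^ 2) + (1 + 2 * ‖ρ₀‖) / ‖ρ₀‖ ^ 4 := by
  have hre : ρ₀.re = 1 / 2 := ntz_re hRH hρ₀
  refine poleData_Psi hRH hsimp hδ hC hN (r := 1 / 16) (by norm_num) (by norm_num) hρ₀ ?_
  intro z hz
  have hz' : |z.re - 1 / 2| ≤ 1 / 8 ∧ |z.im| ≤ |ρ₀.im| + 1 / 8 := by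
    rcases hz with h | h
    · have h1 := (Complex.abs_re_le_norm (z - ρ₀)).trans h
      have h2 := (Complex.abs_im_le_norm (z - ρ₀)).trans h
      rw [sub_re, hre] at h1; rw [sub_im] at h2
      constructor
      · linarith
      · have := abs_sub_abs_le_abs_sub z.im ρ₀.im; linarith
    · have h1 := (Complex.abs_re_le_norm (z - (1 - ρ₀))).trans h
      have h2 := (Complex.abs_im_le_norm (z - (1 - ρ₀))).trans h
      rw [sub_re, sub_re, one_re, hre] at h1; rw [sub_im, sub_im, one_im, zero_sub] at h2
      norm_num at h1
      constructor
      · linarith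
      · have := abs_sub_abs_le_abs_sub z.im (-ρ₀.im); rw [abs_neg] at this; linarith
  have hb := abs_le.1 hz'.1
  refine (hCs z (by linarith [hb.1]) (by linarith [hb.2])).trans ?_
  have hCs0 : 0 ≤ Cs := by
    have := hCs (1 / 2 : ℂ) (by norm_num) (by norm_num)
    have h0 : 0 < (2 + |(1 / 2 : ℂ).im|) ^ (2 * (1 / 8 : ℝ)) := by positivity
    nlinarith [norm_nonneg (riemannZeta (1 / 2 : ℂ))]
  refine mul_le_mul_of_nonneg_left ?_ hCs0
  rw [show 2 * (1 / 8 : ℝ) = 1 / 4 by norm_num]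
  exact Real.rpow_le_rpow (by positivity) (by linarith [hz'.2]) (by norm_num)

/-! ## The main term -/

/-- **The main term of Theorem 1.** Assume RH, simple zeros and condition (2) with `0 < δ ≤ 1`, and let
`0 < ε ≤ 1/16`. There is `R` such that for every `N ≥ 2` the function `y ↦ Ψ_N(1/2 − ε + iy)` is
integrable and
`‖∫ Ψ_N(1/2 − ε + iy) dy + 2π log N · ∑_ρ 1/(ρ(1−ρ))‖ ≤ R`
(the sum over the distinct non-trivial zeros; under RH `ρ(1−ρ) = |ρ|²`).
[cite: BettinConreyFarmer2013, §3, proof of Thm. 1 (last display)] -/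
theorem exists_main_term (hRH : RiemannHypothesis)
    (hsimp : ∀ ρ : ℂ, riemannZeta ρ = 0 → 0 < ρ.re → ρ.re < 1 → deriv riemannZeta ρ ≠ 0)
    {δ C : ℝ} (hδ : 0 < δ) (hδ1 : δ ≤ 1)
    (hC : ∀ T : ℝ, 2 ≤ T →
      ∑ᶠ ρ ∈ zetaZeroBox 0 T, 1 / ‖deriv riemannZeta ρ‖ ^ 2 ≤ C * T ^ (3 / 2 - δ))
    {ε : ℝ} (hε : 0 < ε) (hε16 : ε ≤ 1 / 16) :
    ∃ R : ℝ, ∀ N : ℕ, 2 ≤ N →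
      Integrable (fun y : ℝ ↦ Psi N (((1 / 2 - ε : ℝ) : ℂ) + y * I)) ∧
      ‖(∫ y : ℝ, Psi N (((1 / 2 - ε : ℝ) : ℂ) + y * I)) +
        2 * π * (Real.log N : ℂ) *
          ∑' ρ : ZetaZeros.riemannZetaNontrivialZeros, (1 : ℂ) / ((ρ : ℂ) * (1 - ρ))‖ ≤ R := by
  classical
  -- constants
  obtain ⟨K', hK'0, hK'⟩ := exists_integral_Psi_line hRH hsimp hδ hδ1 hC hε hε16
  obtain ⟨c₀, hc₀, hgh⟩ := ZetaLogDerivRH.exists_goodHeight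
  obtain ⟨Kh, hKh0, hKh⟩ := exists_norm_Psi_horizontal_le hRH hsimp hδ hC hε hε16 hc₀
  obtain ⟨Cs, hCs0, hCs⟩ := exists_norm_zeta_le_strip hRH (η := 1 / 8) (by norm_num) (by norm_num)
  set Err : ZetaZeros.riemannZetaNontrivialZeros → ℝ := fun ρ ↦
    3 * (Cs * (3 + |(ρ : ℂ).im|) ^ (1 / 4 : ℝ) / (1 / 16) / (1 / 16)) /
      (‖deriv riemannZeta ρ‖ * ‖(ρ : ℂ)‖ ^ 2) + (1 + 2 * ‖(ρ : ℂ)‖) / ‖(ρ : ℂ)‖ ^ 4 with hErr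
  have hErrsum : Summable Err := summable_err hRH hδ hC hCs0
  have hErr0 : ∀ ρ, 0 ≤ Err ρ := fun ρ ↦ by rw [hErr]; positivity
  set Rerr : ℝ := ∑' ρ, Err ρ with hRerr
  have hinvsum := summable_inv_norm_sq hRH
  refine ⟨K' + 2 * π * Rerr, fun N hN ↦ ?_⟩
  have hL0 : 0 ≤ Real.log N := Real.log_nonneg (by exact_mod_cast (show 1 ≤ N by omega))
  -- (1) pole data and residues
  have hpd : ∀ ρ₀ : ℂ, ρ₀ ∈ ZetaZeros.riemannZetaNontrivialZeros →
      ∃ φ : ℂ → ℂ, ∃ W ∈ 𝓝 ρ₀, DifferentiableOn ℂ φ W ∧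
        (∀ s ∈ W, s ≠ ρ₀ → Psi N s = φ s / (s - ρ₀) ^ 2) ∧
        ‖deriv φ ρ₀ - (Real.log N : ℂ) / (ρ₀ * (1 - ρ₀))‖ ≤
          3 * (Cs * (3 + |ρ₀.im|) ^ (1 / 4 : ℝ) / (1 / 16) / (1 / 16)) /
            (‖deriv riemannZeta ρ₀‖ * ‖ρ₀‖ ^ 2) + (1 + 2 * ‖ρ₀‖) / ‖ρ₀‖ ^ 4 :=
    fun ρ₀ hρ₀ ↦ exists_poleData_all hRH hsimp hδ hC hCs hN hρ₀
  choose! φ W hW hφd hΨ hres using hpd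
  set res : ℂ → ℂ := fun ρ ↦ deriv (φ ρ) ρ with hresdef
  set main : ℂ → ℂ := fun ρ ↦ (Real.log N : ℂ) / (ρ * (1 - ρ)) with hmain
  -- the main part is summable: `‖log N/(ρ(1-ρ))‖ = log N/|ρ|²`
  have hmain_norm : ∀ ρ : ZetaZeros.riemannZetaNontrivialZeros, ‖(1 : ℂ) / ((ρ : ℂ) * (1 - ρ))‖ =
      1 / ‖(ρ : ℂ)‖ ^ 2 := by
    intro ρ
    rw [norm_div, norm_one, norm_mul, one_sub_eq_conj hRH ρ.2, Complex.norm_conj, sq]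
  have hBsum : Summable fun ρ : ZetaZeros.riemannZetaNontrivialZeros ↦ (1 : ℂ) / ((ρ : ℂ) * (1 - ρ)) :=
    Summable.of_norm (hinvsum.congr fun ρ ↦ (hmain_norm ρ).symm)
  have hmainsum : Summable fun ρ : ZetaZeros.riemannZetaNontrivialZeros ↦ main ρ := by
    have := hBsum.mul_left (Real.log N : ℂ)
    refine this.congr fun ρ ↦ ?_
    simp only [hmain]; ring
  -- the error part
  have hg : ∀ ρ : ZetaZeros.riemannZetaNontrivialZeros, ‖res ρ - main ρ‖ ≤ Err ρ := fun ρ ↦ hres ρ ρ.2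
  have hgsum : Summable fun ρ : ZetaZeros.riemannZetaNontrivialZeros ↦ res ρ - main ρ :=
    Summable.of_norm_bounded hErrsum hg
  have hressum : Summable fun ρ : ZetaZeros.riemannZetaNontrivialZeros ↦ res ρ := by
    have := hgsum.add hmainsum
    exact this.congr fun ρ ↦ by ring
  have hres_eq : ∑' ρ : ZetaZeros.riemannZetaNontrivialZeros, res ρ =
      (∑' ρ : ZetaZeros.riemannZetaNontrivialZeros, (res ρ - main ρ)) +
        (Real.log N : ℂ) * ∑' ρ : ZetaZeros.riemannZetaNontrivialZeros, (1 : ℂ) / ((ρ : ℂ) * (1 - ρ)) := by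
    rw [← tsum_mul_left, ← hgsum.tsum_add (hBsum.mul_left _)]
    refine tsum_congr fun ρ ↦ ?_
    simp only [hmain]; ring
  have hgnorm : ‖∑' ρ : ZetaZeros.riemannZetaNontrivialZeros, (res ρ - main ρ)‖ ≤ Rerr :=
    (norm_tsum_le_tsum_norm hgsum.norm).trans (hgsum.norm.tsum_le_tsum hg hErrsum)
  -- (2) the good heights
  choose T hTI hTgood using fun n : ℕ ↦ hgh ((n : ℝ) + 2)
  have hT2 : ∀ n, 2 ≤ T n := fun n ↦ by have := (hTI n).1; have : (0:ℝ) ≤ n := n.cast_nonneg; linarith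
  have hTpos : ∀ n, 0 < T n := fun n ↦ by linarith [hT2 n]
  have hTabs : ∀ n, |T n| = T n := fun n ↦ abs_of_pos (hTpos n)
  have hTlim : Tendsto T atTop atTop :=
    tendsto_atTop_mono (fun n ↦ by linarith [(hTI n).1]) tendsto_natCast_atTop_atTop
  set dec : ℕ → ℝ := fun n ↦ Kh * (N : ℝ) ^ ε * (T n) ^ (-(1 / 8 : ℝ)) with hdec
  have hdeclim : Tendsto dec atTop (𝓝 0) := by
    have h1 : Tendsto (fun n ↦ (T n) ^ (-(1 / 8 : ℝ))) atTop (𝓝 0) :=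
      (tendsto_rpow_neg_atTop (by norm_num : (0 : ℝ) < 1 / 8)).comp hTlim
    have := h1.const_mul (Kh * (N : ℝ) ^ ε)
    rw [mul_zero] at this
    exact this.congr fun n ↦ by simp [hdec]
  -- (3) the residue theorem between `Re s = 1/2 - ε` and `Re s = 1/2 + ε`
  have hab : (1 / 2 - ε : ℝ) < 1 / 2 + ε := by linarith
  have habs1 : |(1 / 2 - ε : ℝ) - 1 / 2| = ε := by
    rw [show (1 / 2 - ε : ℝ) - 1 / 2 = -ε by ring, abs_neg, abs_of_pos hε]
  have habs2 : |(1 / 2 + ε : ℝ) - 1 / 2| = ε := by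
    rw [show (1 / 2 + ε : ℝ) - 1 / 2 = ε by ring, abs_of_pos hε]
  obtain ⟨hIa, hIa'⟩ := hK' N hN (1 / 2 - ε) habs1
  obtain ⟨hIb, hIb'⟩ := hK' N hN (1 / 2 + ε) habs2
  have hstrip := Literature.Analysis.Complex.integral_vertical_sub_eq_tsum_of_doublePoles
    (F := Psi N) hab ZetaZeros.riemannZetaNontrivialZeros res ?_ ?_ ?_ ?_ hressum hIa hIb T dec
    hTlim hdeclim ?_ ?_
  rotate_left
  · intro p hp; rw [ntz_re hRH hp]; constructor <;> linarith
  · exact fun M ↦ ntz_finite_abs_im_le M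
  · intro z h1 h2 hz
    exact analyticAt_Psi hRH hδ hC hN (by linarith) (by linarith) hz
  · intro p hp
    exact ⟨φ p, W p, hW p hp, hφd p hp, rfl, hΨ p hp⟩
  · intro n p hp
    have hpR : p ∈ zetaZerosRight :=
      ⟨ZetaZeros.riemannZetaNontrivialZeros.zeta_eq_zero hp, by rw [ntz_re hRH hp]; norm_num⟩
    have h1 := hTgood n p hpR
    have h2 := goodHeight_neg (hTgood n) p hpR
    rw [hTabs n] at h1
    rw [abs_neg, hTabs n] at h2
    have hpos : 0 < c₀ / Real.log (T n + 2) := div_pos hc₀ (Real.log_pos (by linarith [hT2 n]))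
    intro h
    rcases (abs_eq (hTpos n).le).1 h with h' | h'
    · rw [h', sub_self, abs_zero] at h1; linarith
    · rw [h', show -T n - -T n = 0 by ring, abs_zero] at h2; linarith
  · intro n x hx
    have hgood' : ∀ ρ ∈ zetaZerosRight, c₀ / Real.log (|T n| + 2) ≤ |ρ.im - T n| := hTgood n
    have h1 := hKh N hN (T n) (hT2 n) hgood' x hx 1 (Or.inl rfl)
    have h2 := hKh N hN (T n) (hT2 n) hgood' x hx (-1) (Or.inr rfl)
    simp only [Complex.ofReal_one, one_mul] at h1
    refine ⟨h1, ?_⟩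
    have e : (x : ℂ) - T n * I = x + ((-1 : ℝ) * T n : ℝ) * I := by push_cast; ring
    rw [e]
    convert h2 using 2
    push_cast; ring
  -- (4) assemble
  refine ⟨hIa, ?_⟩
  have hsub : (∫ y : ℝ, Psi N (((1 / 2 - ε : ℝ) : ℂ) + y * I)) =
      (∫ y : ℝ, Psi N (((1 / 2 + ε : ℝ) : ℂ) + y * I)) -
        2 * π * ∑' ρ : ZetaZeros.riemannZetaNontrivialZeros, res ρ := by
    apply mul_left_cancel₀ I_ne_zero
    linear_combination -hstrip
  rw [hsub, hres_eq]
  have hNε : (N : ℝ) ^ (1 / 2 - (1 / 2 + ε)) ≤ 1 := by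
    rw [show (1 / 2 - (1 / 2 + ε) : ℝ) = -ε by ring]
    exact Real.rpow_le_one_of_one_le_of_nonpos (by exact_mod_cast (show 1 ≤ N by omega)) (by linarith)
  have hπ : 0 < π := Real.pi_pos
  calc ‖(∫ y : ℝ, Psi N (((1 / 2 + ε : ℝ) : ℂ) + y * I)) -
        2 * π * ((∑' ρ : ZetaZeros.riemannZetaNontrivialZeros, (res ρ - main ρ)) +
          (Real.log N : ℂ) * ∑' ρ : ZetaZeros.riemannZetaNontrivialZeros, (1 : ℂ) / ((ρ : ℂ) * (1 - ρ))) +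
        2 * π * (Real.log N : ℂ) *
          ∑' ρ : ZetaZeros.riemannZetaNontrivialZeros, (1 : ℂ) / ((ρ : ℂ) * (1 - ρ))‖
      = ‖(∫ y : ℝ, Psi N (((1 / 2 + ε : ℝ) : ℂ) + y * I)) -
          2 * π * ∑' ρ : ZetaZeros.riemannZetaNontrivialZeros, (res ρ - main ρ)‖ := by
        congr 1; ring
    _ ≤ ‖∫ y : ℝ, Psi N (((1 / 2 + ε : ℝ) : ℂ) + y * I)‖ +
          ‖(2 * π : ℂ) * ∑' ρ : ZetaZeros.riemannZetaNontrivialZeros, (res ρ - main ρ)‖ := norm_sub_le _ _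
    _ ≤ K' * (N : ℝ) ^ (1 / 2 - (1 / 2 + ε)) + 2 * π * Rerr := by
        refine add_le_add hIb' ?_
        rw [norm_mul, show ‖(2 * π : ℂ)‖ = 2 * π by
          rw [show (2 * π : ℂ) = ((2 * π : ℝ) : ℂ) by push_cast; ring, Complex.norm_real,
            Real.norm_eq_abs, abs_of_pos (by positivity)]]
        exact mul_le_mul_of_nonneg_left hgnorm (by positivity)
    _ ≤ K' + 2 * π * Rerr := by nlinarith

end BCF

end Literature.NumberTheory.LFunctions

end
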